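import Summits.Ventures.WeilGRH.OnePrimeTransfer
import HarnessLib

/-!
# GRH arm (rh-explicit, venture WeilGRH): the cleared reflection criterion — monotonicity and numbers

Service lemmas for `ReflectionRungs.lean` (independent of the analytic files `ReflectionInequality` /
`ReflectionTransfer`):
* `reflection_criterion_of_bounds`: the cleared criterion
  `2·[C_M (B² − k'²σ) + 2B (B·C_A − k'·ρ·I_A)] ≤ B (B² − k'²σ)` follows from upper bounds on
  `C_M, C_A`, a lower bound on `I_A`, two-sided bounds on `k'` and the same inequality between the
  bounds (a rational check);
* `reflection_criterion_interpolate`: on the curve `ρ = σ/2` the criterion is affine in `σ`, and it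
  improves with `ρ`; so two endpoint checks cover `σ₀ ≤ σ ≤ σ₁`, `ρ ≥ σ/2` — and `ρ ≥ σ/2` always holds
  for `u = 1 − χ(2)` because `‖χ(2)‖ ≤ 1` (`normSq_one_sub_half_le_re`);
* the numerical constants: `√2, √3` by squaring, `k' = log 2/√2 ∈ [0.49012, 0.49014]`,
  the closed forms at `a = (log 3)/2` (`sinh(log 2 − (log 3)/2) = √3/12`, `cosh((log 2)/2) = 3√2/4`,
  `sinh((log 3 − log 2)/2) = 1/(2√2√3)`) with `C_M ≤ 0.28818`, `C_A ≤ 0.41925`, `I_A ≥ 0.41915`, and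
  at `a = 2/5` through `e^{2/5} ∈ [1.4918246, 1.4918248]` (`Real.exp_bound`) with
  `C_M ≤ 0.590512`, `C_A ≤ 0.110122`, `I_A ≥ 0.110116`.

## References

* Mathlib's `Real.log_two_near_10`, `Real.log_three_near_10`, `Real.exp_bound`; folklore.
-/

noncomputable section

open Complex Filter Set MeasureTheory
open scoped Real Topology ComplexConjugate

namespace Summit.Ventures.WeilGRH

open Literature.NumberTheory.LFunctions

/-! ## Monotonicity and interpolation of the cleared criterion -/

/-- The cleared reflection criterion is monotone in its ingredients: upper bounds for `C_M, C_A`,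
a lower bound for `I_A`, two-sided bounds for `k'` and a rational check imply it. [folklore] -/
theorem reflection_criterion_of_bounds {CM CA IA k ρ σ B CMu CAu IAl kl ku : ℝ}
    (hCM : CM ≤ CMu) (hCA : CA ≤ CAu) (hIA : IAl ≤ IA) (hIAl : 0 ≤ IAl) (hρ : 0 ≤ ρ)
    (hσ : 0 ≤ σ) (hkl : kl ≤ k) (hku : k ≤ ku) (hkl0 : 0 ≤ kl) (hB : 0 < B) (hCMu : 0 ≤ CMu)
    (hBk : ku ^ 2 * σ ≤ B ^ 2)
    (hnum : 2 * (CMu * (B ^ 2 - kl ^ 2 * σ) + 2 * B * (B * CAu - kl * ρ * IAl)) ≤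
      B * (B ^ 2 - ku ^ 2 * σ)) :
    2 * (CM * (B ^ 2 - k ^ 2 * σ) + 2 * B * (B * CA - k * ρ * IA)) ≤ B * (B ^ 2 - k ^ 2 * σ) := by
  have hk0 : 0 ≤ k := hkl0.trans hkl
  have e1 : k ^ 2 * σ ≤ ku ^ 2 * σ :=
    mul_le_mul_of_nonneg_right (pow_le_pow_left₀ hk0 hku 2) hσ
  have e2 : kl ^ 2 * σ ≤ k ^ 2 * σ :=
    mul_le_mul_of_nonneg_right (pow_le_pow_left₀ hkl0 hkl 2) hσ
  have e3 : CM * (B ^ 2 - k ^ 2 * σ) ≤ CMu * (B ^ 2 - k ^ 2 * σ) :=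
    mul_le_mul_of_nonneg_right hCM (by linarith)
  have e4 : CMu * (B ^ 2 - k ^ 2 * σ) ≤ CMu * (B ^ 2 - kl ^ 2 * σ) :=
    mul_le_mul_of_nonneg_left (by linarith) hCMu
  have e5 : kl * ρ * IAl ≤ k * ρ * IA :=
    mul_le_mul (mul_le_mul_of_nonneg_right hkl hρ) hIA hIAl (mul_nonneg hk0 hρ)
  have e6 : B * CA ≤ B * CAu := mul_le_mul_of_nonneg_left hCA hB.le
  have e7 : 2 * B * (B * CA - k * ρ * IA) ≤ 2 * B * (B * CAu - kl * ρ * IAl) :=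
    mul_le_mul_of_nonneg_left (by linarith) (by linarith)
  have e8 : B * (B ^ 2 - ku ^ 2 * σ) ≤ B * (B ^ 2 - k ^ 2 * σ) :=
    mul_le_mul_of_nonneg_left (by linarith) hB.le
  linarith

/-- On the curve `ρ = σ/2` the cleared criterion is affine in `σ`, and it improves with `ρ`: if it
holds at `σ₀` and `σ₁` (with `ρ = σ/2`) then it holds for `σ₀ ≤ σ ≤ σ₁` and every `ρ ≥ σ/2`. [folklore] -/
theorem reflection_criterion_interpolate {CM CA IA k B σ₀ σ₁ σ ρ : ℝ} (hk : 0 ≤ k)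
    (hIA : 0 ≤ IA) (hB : 0 ≤ B)
    (h0 : 2 * (CM * (B ^ 2 - k ^ 2 * σ₀) + 2 * B * (B * CA - k * (σ₀ / 2) * IA)) ≤
      B * (B ^ 2 - k ^ 2 * σ₀))
    (h1 : 2 * (CM * (B ^ 2 - k ^ 2 * σ₁) + 2 * B * (B * CA - k * (σ₁ / 2) * IA)) ≤
      B * (B ^ 2 - k ^ 2 * σ₁))
    (hσ0 : σ₀ ≤ σ) (hσ1 : σ ≤ σ₁) (hρ : σ / 2 ≤ ρ) :
    2 * (CM * (B ^ 2 - k ^ 2 * σ) + 2 * B * (B * CA - k * ρ * IA)) ≤ B * (B ^ 2 - k ^ 2 * σ) := by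
  -- first on the curve
  have hcurve : 2 * (CM * (B ^ 2 - k ^ 2 * σ) + 2 * B * (B * CA - k * (σ / 2) * IA)) ≤
      B * (B ^ 2 - k ^ 2 * σ) := by
    rcases eq_or_lt_of_le (hσ0.trans hσ1) with heq | hlt
    · have hσ : σ = σ₀ := le_antisymm (heq ▸ hσ1) hσ0
      rw [hσ]; exact h0
    · -- affine interpolation
      have key : (σ₁ - σ₀) * (B * (B ^ 2 - k ^ 2 * σ) -
          2 * (CM * (B ^ 2 - k ^ 2 * σ) + 2 * B * (B * CA - k * (σ / 2) * IA))) =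
          (σ₁ - σ) * (B * (B ^ 2 - k ^ 2 * σ₀) -
            2 * (CM * (B ^ 2 - k ^ 2 * σ₀) + 2 * B * (B * CA - k * (σ₀ / 2) * IA))) +
          (σ - σ₀) * (B * (B ^ 2 - k ^ 2 * σ₁) -
            2 * (CM * (B ^ 2 - k ^ 2 * σ₁) + 2 * B * (B * CA - k * (σ₁ / 2) * IA))) := by
        ring
      have hnn : 0 ≤ (σ₁ - σ₀) * (B * (B ^ 2 - k ^ 2 * σ) -
          2 * (CM * (B ^ 2 - k ^ 2 * σ) + 2 * B * (B * CA - k * (σ / 2) * IA))) := by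
        rw [key]
        exact add_nonneg (mul_nonneg (by linarith) (by linarith))
          (mul_nonneg (by linarith) (by linarith))
      have hpos : 0 < σ₁ - σ₀ := by linarith
      have := nonneg_of_mul_nonneg_right (by rwa [mul_comm] at hnn) hpos
      linarith
  -- then off the curve
  have hgain : 2 * B * (B * CA - k * ρ * IA) ≤ 2 * B * (B * CA - k * (σ / 2) * IA) := by
    have : k * (σ / 2) * IA ≤ k * ρ * IA :=
      mul_le_mul_of_nonneg_right (mul_le_mul_of_nonneg_left hρ hk) hIA
    exact mul_le_mul_of_nonneg_left (by linarith) (by linarith)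
  linarith

/-- `‖1 − z‖²/2 ≤ Re(1 − z)` for `‖z‖ ≤ 1` (`‖1 − z‖² = 1 − 2Re z + ‖z‖² ≤ 2 − 2Re z`): the values
`χ(2)` of a Dirichlet character lie in the closed unit disc, so the curve `Re u = ‖u‖²/2` is the
worst case of the criterion. [folklore] -/
theorem normSq_one_sub_half_le_re {z : ℂ} (hz : ‖z‖ ≤ 1) : ‖1 - z‖ ^ 2 / 2 ≤ (1 - z).re := by
  have h1 : ‖1 - z‖ ^ 2 = (1 - z.re) ^ 2 + z.im ^ 2 := by
    rw [Complex.sq_norm, Complex.normSq_apply]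
    simp only [sub_re, one_re, sub_im, one_im, zero_sub]
    ring
  have h2 : z.re ^ 2 + z.im ^ 2 ≤ 1 := by
    have h := Complex.sq_norm z
    rw [Complex.normSq_apply] at h
    nlinarith [norm_nonneg z]
  rw [h1, sub_re, one_re]
  nlinarith

/-- `‖1 − χ(2)‖² ≤ 4`. [folklore] -/
theorem normSq_one_sub_char_le_four {q : ℕ} (χ : DirichletCharacter ℂ q) :
    ‖1 - χ (2 : ZMod q)‖ ^ 2 ≤ 4 := by
  have h : ‖1 - χ (2 : ZMod q)‖ ≤ 2 := by
    calc ‖1 - χ (2 : ZMod q)‖ ≤ ‖(1 : ℂ)‖ + ‖χ (2 : ZMod q)‖ := norm_sub_le _ _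
      _ ≤ 1 + 1 := by rw [norm_one]; exact add_le_add le_rfl (χ.norm_le_one _)
      _ = 2 := by norm_num
  nlinarith [norm_nonneg (1 - χ (2 : ZMod q))]

/-! ## Numerical constants -/

/-- `1.414213 < √2 < 1.414214`. [folklore] -/
theorem sqrt_two_bounds : (1.414213 : ℝ) < Real.sqrt 2 ∧ Real.sqrt 2 < 1.414214 :=
  ⟨(Real.lt_sqrt (by norm_num)).2 (by norm_num), (Real.sqrt_lt' (by norm_num)).2 (by norm_num)⟩

/-- `1.73205 < √3 < 1.732051`. [folklore] -/
theorem sqrt_three_bounds : (1.73205 : ℝ) < Real.sqrt 3 ∧ Real.sqrt 3 < 1.732051 :=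
  ⟨(Real.lt_sqrt (by norm_num)).2 (by norm_num), (Real.sqrt_lt' (by norm_num)).2 (by norm_num)⟩

/-- `0.49012 ≤ k' = log 2/√2 ≤ 0.49014`. [folklore] -/
theorem kprime_bounds :
    (0.49012 : ℝ) ≤ Real.log 2 / Real.sqrt 2 ∧ Real.log 2 / Real.sqrt 2 ≤ 0.49014 := by
  obtain ⟨hs1, hs2⟩ := sqrt_two_bounds
  have hl1 := Real.log_two_gt_d9
  have hl2 := Real.log_two_lt_d9
  have hs0 : 0 < Real.sqrt 2 := by positivity
  constructor
  · rw [le_div_iff₀ hs0]; nlinarith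
  · rw [div_le_iff₀ hs0]; nlinarith

/- `e^{(log c)/2} = √c` is the tree's `Literature.NumberTheory.LFunctions.exp_log_half`
(MertensOneSided.lean, heavy imports); the two-line proof is inlined below where needed. -/

/-- `cosh((log 2)/2) = 3√2/4` (`e^{(log 2)/2} = √2`). [folklore] -/
theorem cosh_log_two_half : Real.cosh (Real.log 2 / 2) = 3 * Real.sqrt 2 / 4 := by
  have hs : Real.sqrt 2 ≠ 0 := by positivity
  have hsq : Real.sqrt 2 * Real.sqrt 2 = 2 := Real.mul_self_sqrt (by norm_num)
  rw [Real.cosh_eq, Real.exp_neg,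
    (by rw [Real.sqrt_eq_rpow, Real.rpow_def_of_pos (by norm_num : (0:ℝ) < 2)]; ring_nf :
      Real.exp (Real.log 2 / 2) = Real.sqrt 2)]
  field_simp
  nlinarith [hsq]

/-- `sinh(log 2 − (log 3)/2) = √3/12` (`e^{m} = 2/√3`). [folklore] -/
theorem sinh_log_two_sub_log_three_half :
    Real.sinh (Real.log 2 - Real.log 3 / 2) = Real.sqrt 3 / 12 := by
  have hs : Real.sqrt 3 ≠ 0 := by positivity
  have hsq : Real.sqrt 3 * Real.sqrt 3 = 3 := Real.mul_self_sqrt (by norm_num)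
  have he : Real.exp (Real.log 2 - Real.log 3 / 2) = 2 / Real.sqrt 3 := by
    rw [Real.exp_sub, Real.exp_log (by norm_num),
      (by rw [Real.sqrt_eq_rpow, Real.rpow_def_of_pos (by norm_num : (0:ℝ) < 3)]; ring_nf :
      Real.exp (Real.log 3 / 2) = Real.sqrt 3)]
  rw [Real.sinh_eq, Real.exp_neg, he]
  field_simp
  nlinarith [hsq]

/-- `sinh((log 3)/2 − (log 2)/2) = 1/(2√2√3)` (`e^{(log 3 − log 2)/2} = √3/√2`). [folklore] -/
theorem sinh_log_three_half_sub_log_two_half :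
    Real.sinh (Real.log 3 / 2 - Real.log 2 / 2) = 1 / (2 * (Real.sqrt 2 * Real.sqrt 3)) := by
  have hs2 : Real.sqrt 2 ≠ 0 := by positivity
  have hs3 : Real.sqrt 3 ≠ 0 := by positivity
  have hsq2 : Real.sqrt 2 * Real.sqrt 2 = 2 := Real.mul_self_sqrt (by norm_num)
  have hsq3 : Real.sqrt 3 * Real.sqrt 3 = 3 := Real.mul_self_sqrt (by norm_num)
  have he : Real.exp (Real.log 3 / 2 - Real.log 2 / 2) = Real.sqrt 3 / Real.sqrt 2 := by
    rw [Real.exp_sub,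
      (by rw [Real.sqrt_eq_rpow, Real.rpow_def_of_pos (by norm_num : (0:ℝ) < 3)]; ring_nf :
      Real.exp (Real.log 3 / 2) = Real.sqrt 3),
      (by rw [Real.sqrt_eq_rpow, Real.rpow_def_of_pos (by norm_num : (0:ℝ) < 2)]; ring_nf :
      Real.exp (Real.log 2 / 2) = Real.sqrt 2)]
  rw [Real.sinh_eq, Real.exp_neg, he]
  field_simp
  nlinarith [hsq2, hsq3]

/-- The constants of the rung `(log 3)/2`: `C_M ≤ 0.28818`, `C_A ≤ 0.41925`, `0.41915 ≤ I_A`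
(`C_M = √3/12 + log 2 − (log 3)/2`, `C_A = √3/8 + (log 3 − log 2)/2`,
`I_A = 3√2(log 3 − log 2)/8 + 1/(2√2√3)`). [folklore] -/
theorem log_three_half_constants :
    Real.sinh (Real.log 2 - Real.log 3 / 2) + (Real.log 2 - Real.log 3 / 2) ≤ 0.28818 ∧
    (Real.sinh (Real.log 3 / 2) - Real.sinh (Real.log 2 - Real.log 3 / 2) +
        (Real.log 3 / 2 - (Real.log 2 - Real.log 3 / 2))) / 2 ≤ 0.41925 ∧
    (0.41915 : ℝ) ≤ (Real.log 3 / 2 - (Real.log 2 - Real.log 3 / 2)) * Real.cosh (Real.log 2 / 2) / 2 +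
        Real.sinh (Real.log 3 / 2 - Real.log 2 / 2) := by
  obtain ⟨hs1, hs2⟩ := sqrt_two_bounds
  obtain ⟨ht1, ht2⟩ := sqrt_three_bounds
  have hl1 := Real.log_two_gt_d9
  have hl2 := Real.log_two_lt_d9
  have hm1 := Real.log_three_gt_d9
  have hm2 := Real.log_three_lt_d9
  have h3 : Real.sqrt 3 * Real.sqrt 3 = 3 := Real.mul_self_sqrt (by norm_num)
  rw [sinh_log_two_sub_log_three_half, sinh_log_three_half, cosh_log_two_half,
    sinh_log_three_half_sub_log_two_half]
  refine ⟨by linarith, ?_, ?_⟩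
  · have h13 : 1 / Real.sqrt 3 = Real.sqrt 3 / 3 := by
      field_simp; linarith [h3]
    rw [h13]
    linarith
  · have hprod : (0.20412 : ℝ) ≤ 1 / (2 * (Real.sqrt 2 * Real.sqrt 3)) := by
      rw [le_div_iff₀ (by positivity)]
      nlinarith [mul_pos (show (0:ℝ) < Real.sqrt 2 by positivity)
        (show (0:ℝ) < Real.sqrt 3 by positivity)]
    nlinarith

/-- `1.4918246 ≤ e^{2/5} ≤ 1.4918248` (Taylor with remainder, 9 terms). [folklore] -/
theorem exp_two_fifths_bounds :
    (1.4918246 : ℝ) ≤ Real.exp (2 / 5) ∧ Real.exp (2 / 5) ≤ 1.4918248 := by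
  have h := Real.exp_bound (x := 2 / 5) (by rw [abs_of_nonneg (by norm_num)]; norm_num)
    (n := 9) (by norm_num)
  have hs : (∑ m ∈ Finset.range 9, (2 / 5 : ℝ) ^ m / m.factorial) =
      1 + 2 / 5 + (2 / 5) ^ 2 / 2 + (2 / 5) ^ 3 / 6 + (2 / 5) ^ 4 / 24 + (2 / 5) ^ 5 / 120 +
        (2 / 5) ^ 6 / 720 + (2 / 5) ^ 7 / 5040 + (2 / 5) ^ 8 / 40320 := by
    simp [Finset.sum_range_succ, Nat.factorial]
  rw [hs, abs_of_nonneg (by norm_num : (0 : ℝ) ≤ 2 / 5)] at h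
  norm_num [Nat.factorial] at h
  obtain ⟨h1, h2⟩ := abs_sub_le_iff.1 h
  constructor <;> linarith

/-- The constants of the rung `2/5` (`E = e^{2/5}`: `sinh(2/5) = (E − E⁻¹)/2`,
`sinh(log 2 − 2/5) = 1/E − E/4`, `sinh(2/5 − (log 2)/2) = (E/√2 − √2/E)/2`):
`C_M ≤ 0.590512`, `C_A ≤ 0.110122`, `0.110116 ≤ I_A`. [folklore] -/
theorem two_fifths_constants :
    Real.sinh (Real.log 2 - 2 / 5) + (Real.log 2 - 2 / 5) ≤ 0.590512 ∧
    (Real.sinh (2 / 5) - Real.sinh (Real.log 2 - 2 / 5) + (2 / 5 - (Real.log 2 - 2 / 5))) / 2 ≤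
      0.110122 ∧
    (0.110116 : ℝ) ≤ (2 / 5 - (Real.log 2 - 2 / 5)) * Real.cosh (Real.log 2 / 2) / 2 +
        Real.sinh (2 / 5 - Real.log 2 / 2) := by
  obtain ⟨hs1, hs2⟩ := sqrt_two_bounds
  obtain ⟨he1, he2⟩ := exp_two_fifths_bounds
  have hl1 := Real.log_two_gt_d9
  have hl2 := Real.log_two_lt_d9
  set E := Real.exp (2 / 5) with hE
  have hE0 : 0 < E := Real.exp_pos _
  have hsq : Real.sqrt 2 * Real.sqrt 2 = 2 := Real.mul_self_sqrt (by norm_num)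
  have hs0 : 0 < Real.sqrt 2 := by positivity
  have hsinh1 : Real.sinh (2 / 5) = (E - E⁻¹) / 2 := by
    rw [Real.sinh_eq, Real.exp_neg]
  have hsinh2 : Real.sinh (Real.log 2 - 2 / 5) = E⁻¹ - E / 4 := by
    rw [Real.sinh_eq, Real.exp_neg, Real.exp_sub, Real.exp_log (by norm_num), ← hE]
    field_simp
    ring
  have hsinh3 : Real.sinh (2 / 5 - Real.log 2 / 2) = (E / Real.sqrt 2 - Real.sqrt 2 / E) / 2 := by
    rw [Real.sinh_eq, Real.exp_neg, Real.exp_sub,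
      (by rw [Real.sqrt_eq_rpow, Real.rpow_def_of_pos (by norm_num : (0:ℝ) < 2)]; ring_nf :
      Real.exp (Real.log 2 / 2) = Real.sqrt 2), ← hE]
    field_simp
  have hinv1 : E⁻¹ ≤ 1 / 1.4918246 := by
    rw [inv_eq_one_div]; exact one_div_le_one_div_of_le (by norm_num) he1
  have hinv2 : 1 / 1.4918248 ≤ E⁻¹ := by
    rw [inv_eq_one_div]; exact one_div_le_one_div_of_le hE0 he2
  rw [hsinh1, hsinh2, hsinh3, cosh_log_two_half]
  refine ⟨?_, ?_, ?_⟩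
  · norm_num at hinv1 ⊢; linarith
  · norm_num at hinv2 ⊢; linarith
  · -- `E/√2 − √2/E ≥ 1.4918246/1.414214 − 1.414214/1.4918246`
    have hq1 : (1.4918246 : ℝ) / 1.414214 ≤ E / Real.sqrt 2 := by
      rw [div_le_div_iff₀ (by norm_num) hs0]; nlinarith
    have hq2 : Real.sqrt 2 / E ≤ 1.414214 / 1.4918246 := by
      rw [div_le_div_iff₀ hE0 (by norm_num)]; nlinarith
    norm_num at hq1 hq2 ⊢
    nlinarith

end Summit.Ventures.WeilGRH
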